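import HarnessLib
import Summits.Langlands.Langlands.Theses.RepeatedRootSocle
import Summits.Langlands.Langlands.Theorems.SectorComplement.Negative.RepeatedRootSocleVacuity

/-!
# `SectorComplementR` of route `RepeatedRootSocle` (stmt-Langlands-18146) — junction vetting
# (negative lane): the K0 determinant test is CONSUMED by the repaired typing, and the exact
# logical position of the junction between the sector `UnrefinedWeightTwoLiftingR` and the summit

Refuter crux-attack at birth (seat `refuter-rattack-stmt-Langlands-18146-0`, 2026-08-17) on
`SectorComplementR : Prop := UnrefinedWeightTwoLiftingR → _root_.Langlands` (route
`route-Langlands-RepeatedRootSocle`, rev 5).  Kernel-checked findings: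

* `sympl_cyclotomic_integralFrobCharpoly_constCoeff_sq` — **K0 re-run on the REPAIRED multiplier.**
  For a framed `ρ : Γ_ℚ → GL₄(ℚ̄_p)` symplectic with multiplier the cyclotomic character `ε`
  (homological convention `V_p(A)`, the typing of the live `R`-items) and an integral
  characteristic polynomial `P ∈ ℤ[X]` of arithmetic Frobenius at a place `v ∤ p`, one gets
  `P(0)² = q_v⁴`, i.e. `P(0) = ± q_v²` — CONSISTENT with the Weil polynomial of an abelian surface
  (`P(0) = q_v²`).  Same computation as the rev-≤4 kill
  `SectorComplement.Negative.sympl_invCyclotomic_integralFrobCharpoly_false` (there multiplier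
  `ε⁻¹` gave `P(0)² q_v⁴ = 1`, absurd); here it closes no contradiction: the determinant test that
  sank rev ≤ 4 passes on rev 5, as the planner's kill criterion K0 predicts.
* `repeatedRootSocleR_sympl_pure_constCoeff_sq` — the same with the two hypotheses spelled
  VERBATIM as the `Sympl r` / `Pure r` sub-formulas shared by `UnrefinedWeightTwoLiftingR`,
  `LimitClassicalUnrefinedR`, `PadicLimitUnrefinedR`: at cofinitely many places the integral
  Frobenius polynomial has `P(0)² = q_v⁴`.  (Informational consequence for provers: under the
  R-hypotheses `det ρ(Frob_v) = ± q_v²` a.e.; no new joint unsatisfiability was found — the other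
  pairs checked on paper, see the item note: L-algebraic `π` vs `|α_j| = q_v^{-1/2}` Satake sizes,
  global multiplier `ε` vs the local `P`-ordinary diagonal `(εα, εβ, β⁻¹, α⁻¹)` (both give
  `det = ε²`), and split graded pieces at `α = β` (Tate semisimplicity) are all consistent.)
* `not_sectorComplementR_iff` — `¬ SectorComplementR ↔ (UnrefinedWeightTwoLiftingR ∧ ¬ Langlands)`:
  a refutation of the junction is EXACTLY a proof of the sector theorem together with a
  refutation of the audited summit; none is claimed.
* `sectorComplementR_junction_probes` — the two restates-summit probes recorded as logic:
  `S → C` holds outright (`Langlands → SectorComplementR`, informational `crux.summit-implies`,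
  by design for a complement), and `C → S` holds PRECISELY modulo the sector theorem
  (`SectorComplementR → UnrefinedWeightTwoLiftingR → Langlands`); unlike rev ≤ 4
  (`sectorComplement_iff_langlands`) no unconditional `C → S` is available, because the repaired
  sector is not vacuous (its hypotheses are met in nature, e.g. by `V_p` of a modular abelian
  surface over `ℚ` with trivial endomorphism ring, good ordinary reduction at `p` and large
  residual image — objects the tree cannot yet construct, so this is a citation, not a theorem).

No statement of the route is asserted positively: `SectorComplementR` occurs only under `¬`,
inside `↔`/`∧` packages, or with the sector theorem as an explicit hypothesis. [folklore]
-/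

set_option linter.dupNamespace false -- project-wide option (lakefile weak.linter.dupNamespace); `Summit.Langlands.Langlands` is the mandated namespace

noncomputable section

open scoped NumberField MatrixGroups Matrix
open IsDedekindDomain Field Filter
open Literature.NumberTheory.GaloisRepresentations
open Summit.Langlands.Langlands.Theses.RepeatedRootSocle

namespace Summit.Langlands.Langlands.Theorems.SectorComplementR.Negative

/-- **K0 re-run, repaired multiplier `ε`: the determinant test is consistent.**  If
`ρ : Γ_ℚ → GL₄(ℚ̄_p)` satisfies `ρ(g)ᵀ J ρ(g) = ε(g) • J` for an invertible `J`, `v ∤ p`, and every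
arithmetic Frobenius at `v` has characteristic polynomial `P ∈ ℤ[X]`, then `P(0)² = q_v⁴`
(`det ρ(σ_v)² = ε(σ_v)⁴ = q_v⁴` and `det ρ(σ_v) = P(0)`; an arithmetic Frobenius `σ_v` exists,
`exists_isArithFrobAt_of_mem_primesAbove_holds`, with `ε(σ_v) = q_v`,
`GaloisRep.cyclotomicCharacter_apply_of_isArithFrobAt`).  Contrast
`SectorComplement.Negative.sympl_invCyclotomic_integralFrobCharpoly_false` (multiplier `ε⁻¹`:
`P(0)² q_v⁴ = 1`, absurd). [folklore] -/
theorem sympl_cyclotomic_integralFrobCharpoly_constCoeff_sq (p : ℕ) [Fact p.Prime]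
    (ρ : FramedGaloisRep ℚ (PadicAlgCl p) 4)
    (hS : ρ.IsSymplecticWithMultiplierFun (fun g => algebraMap ℚ_[p] (PadicAlgCl p)
      (((GaloisRep.cyclotomicCharacter ℚ p g : ℤ_[p]ˣ) : ℤ_[p]) : ℚ_[p])))
    {v : HeightOneSpectrum (𝓞 ℚ)} (hv : ((p : ℕ) : 𝓞 ℚ) ∉ v.asIdeal)
    {P : Polynomial ℤ} (hPv : ρ.HasFrobCharpolyAt v (P.map (Int.castRingHom (PadicAlgCl p)))) :
    (P.coeff 0) ^ 2 = (v.residueCard : ℤ) ^ 4 := by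
  classical
  obtain ⟨𝔓, h𝔓⟩ := v.primesAbove_nonempty
  obtain ⟨σ, hσ⟩ := HeightOneSpectrum.exists_isArithFrobAt_of_mem_primesAbove_holds h𝔓
  have hε : ((GaloisRep.cyclotomicCharacter ℚ p σ : ℤ_[p]ˣ) : ℤ_[p]) = (v.residueCard : ℤ_[p]) :=
    GaloisRep.cyclotomicCharacter_apply_of_isArithFrobAt hv h𝔓 hσ
  have hchar : FramedRep.charpoly ρ σ = P.map (Int.castRingHom (PadicAlgCl p)) :=
    hPv 𝔓 h𝔓 σ hσ
  set M : Matrix (Fin 4) (Fin 4) (PadicAlgCl p) :=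
    ((ρ σ : GL (Fin 4) (PadicAlgCl p)) : Matrix (Fin 4) (Fin 4) (PadicAlgCl p)) with hM
  -- det = constant coefficient of the (integral) characteristic polynomial
  have hdet : M.det = ((P.coeff 0 : ℤ) : PadicAlgCl p) := by
    rw [Matrix.det_eq_sign_charpoly_coeff]
    have hc : M.charpoly = P.map (Int.castRingHom (PadicAlgCl p)) := hchar
    rw [hc, Polynomial.coeff_map, Fintype.card_fin]
    norm_num
  -- the multiplier at `σ` IS `q_v`
  set ν : PadicAlgCl p := algebraMap ℚ_[p] (PadicAlgCl p)
      (((GaloisRep.cyclotomicCharacter ℚ p σ : ℤ_[p]ˣ) : ℤ_[p]) : ℚ_[p]) with hν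
  have hνq : ν = (v.residueCard : PadicAlgCl p) := by
    rw [hν, hε, PadicInt.coe_natCast, map_natCast]
  -- symplecticity: `det² = ν⁴`
  obtain ⟨J, -, hJunit, hJ⟩ := hS
  have hdet2 : M.det ^ 2 = ν ^ 4 := by
    have h := congrArg Matrix.det (hJ σ)
    rw [Matrix.det_mul, Matrix.det_mul, Matrix.det_transpose, Matrix.det_smul,
      Fintype.card_fin] at h
    have hJ0 : J.det ≠ 0 := hJunit.ne_zero
    have h' : (M.det ^ 2 - ν ^ 4) * J.det = 0 := by
      rw [sub_mul, sq]
      linear_combination h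
    rcases mul_eq_zero.mp h' with h'' | h''
    · exact sub_eq_zero.mp h''
    · exact absurd h'' hJ0
  -- combine in `ℚ̄_p`, then pull back to `ℤ` along the injective cast
  have hZ : (((P.coeff 0) ^ 2 : ℤ) : PadicAlgCl p) = (((v.residueCard : ℤ) ^ 4 : ℤ) : PadicAlgCl p) := by
    push_cast
    rw [← hdet, hdet2, hνq]
  exact_mod_cast hZ

/-- **The same on the verbatim `Sympl` / `Pure` sub-formulas of the live `R`-items** (shared by
`UnrefinedWeightTwoLiftingR`, `LimitClassicalUnrefinedR`, `PadicLimitUnrefinedR`): at cofinitely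
many places the integral arithmetic-Frobenius polynomial has `P(0)² = q_v⁴` — the repaired
hypothesis pair is consistent with (indeed forces the size of) the Weil constant term, where the
rev-≤4 pair was contradictory (`SectorComplement.Negative.repeatedRootSocle_sympl_pure_false`).
Only `Sympl` and the integrality inside `Pure` are used. [folklore] -/
theorem repeatedRootSocleR_sympl_pure_constCoeff_sq (p : ℕ) [Fact p.Prime]
    (r : FramedGaloisRep ℚ (PadicAlgCl p) 4)
    (hS : r.IsSymplecticWithMultiplierFun (fun g => algebraMap ℚ_[p] (PadicAlgCl p)
      (((GaloisRep.cyclotomicCharacter ℚ p g : ℤ_[p]ˣ) : ℤ_[p]) : ℚ_[p])))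
    (hP : ∀ᶠ v : HeightOneSpectrum (𝓞 ℚ) in Filter.cofinite, r.IsUnramifiedAt v ∧
      ∃ P : Polynomial ℤ, r.HasFrobCharpolyAt v (P.map (Int.castRingHom (PadicAlgCl p))) ∧
        ∀ z : ℂ, (P.map (Int.castRingHom ℂ)).IsRoot z → ‖z‖ ^ 2 = (v.residueCard : ℝ)) :
    ∀ᶠ v : HeightOneSpectrum (𝓞 ℚ) in Filter.cofinite,
      ∃ P : Polynomial ℤ, r.HasFrobCharpolyAt v (P.map (Int.castRingHom (PadicAlgCl p))) ∧
        (P.coeff 0) ^ 2 = (v.residueCard : ℤ) ^ 4 := by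
  classical
  -- the places above `p` form a finite set
  have hfin : {v : HeightOneSpectrum (𝓞 ℚ) | ((p : ℕ) : 𝓞 ℚ) ∈ v.asIdeal}.Finite := by
    have hne : (Ideal.span {((p : ℕ) : 𝓞 ℚ)} : Ideal (𝓞 ℚ)) ≠ ⊥ := by
      rw [Ne, Ideal.span_singleton_eq_bot]
      exact_mod_cast (Fact.out : p.Prime).ne_zero
    refine (Ideal.finite_factors hne).subset ?_
    intro v hv
    simp only [Set.mem_setOf_eq] at hv ⊢
    rw [Ideal.dvd_span_singleton]
    exact hv
  have hcof : ∀ᶠ v : HeightOneSpectrum (𝓞 ℚ) in cofinite, ((p : ℕ) : 𝓞 ℚ) ∉ v.asIdeal := by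
    rw [Filter.eventually_cofinite]
    simpa using hfin
  filter_upwards [hP, hcof] with v hv hpv
  obtain ⟨-, P, hPv, -⟩ := hv
  exact ⟨P, hPv, sympl_cyclotomic_integralFrobCharpoly_constCoeff_sq p r hS hpv hPv⟩

/-- **What a refutation of the junction would be.**  `¬ SectorComplementR` is EQUIVALENT to: the
sector theorem `UnrefinedWeightTwoLiftingR` holds AND the audited summit `Langlands` fails.  So the
item admits no refutation short of refuting the summit (none is claimed), and no proof short of
either refuting the sector (whose hypotheses are met in nature) or proving the rest of
reciprocity. [folklore] -/
theorem not_sectorComplementR_iff :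
    ¬ SectorComplementR ↔ (UnrefinedWeightTwoLiftingR ∧ ¬ _root_.Langlands) := by
  constructor
  · intro h
    by_contra h'
    exact h (fun hX => Classical.by_contradiction fun hL => h' ⟨hX, hL⟩)
  · rintro ⟨hX, hL⟩ h
    exact hL (h hX)

/-- **Restates-summit probes for the repaired junction.**  `S → C`: the summit implies the junction
outright (informational `crux.summit-implies`; a complement is always below the summit).  `C → S`:
the junction gives back the summit EXACTLY through the sector theorem `UnrefinedWeightTwoLiftingR`
— and, unlike rev ≤ 4 (`SectorComplement.Negative.sectorComplement_iff_langlands`, where the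
sector held ex falso), not without it: the repaired sector's hypothesis pair `Sympl`/`Pure` is
consistent (`repeatedRootSocleR_sympl_pure_constCoeff_sq`). [folklore] -/
theorem sectorComplementR_junction_probes :
    (_root_.Langlands → SectorComplementR) ∧
      (SectorComplementR → UnrefinedWeightTwoLiftingR → _root_.Langlands) :=
  ⟨fun hL _ => hL, fun hC hX => hC hX⟩

end Summit.Langlands.Langlands.Theorems.SectorComplementR.Negative

end
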